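import Literature.NumberTheory.EllipticCurves.ComplexPeriod
import Mathlib.Algebra.Module.ZLattice.Covolume
import HarnessLib

/-!
# (COVOL) covolume under a scaled inclusion of period lattices

The lattice-bookkeeping conjunct `(COVOL)` of the `petarea` cut of the print conjunct `(PET)`
`CartanCover.SplitSheetPeterssonDatum` of crux `CartanOnePlaceDegreeLawAtThree`
(`Cruxes/CartanOnePlaceDegreeLawAtThree/Lines/petarea.lean`, `def CovolumeIndex`), proved verbatim:
if `α·Λ₂ ⊆ Λ₁` and `d·Λ₁ ⊆ α·Λ₂` (`d ≥ 1`) for two period lattices `Λ₁, Λ₂ ⊂ ℂ`, then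
`|α|² · covol(Λ₂) = n · covol(Λ₁)` with `n = [Λ₁ : αΛ₂] > 0` and `n ∣ d²`.

Proof: `α ≠ 0` (else `d·ω₁ = 0`); `covol(αΛ₂) = |α|²·covol(Λ₂)` and `covol(dΛ₁) = d²·covol(Λ₁)`
(`PeriodPair.covolume_mulLeft_lattice`); `covol(Λ')∕covol(Λ) = [Λ : Λ']` for `Λ' ≤ Λ`
(`ZLattice.covolume_div_covolume_eq_relIndex'`) applied to `αΛ₂ ≤ Λ₁` (index `n`) and `dΛ₁ ≤ αΛ₂`
(index `m`) gives `m·n·covol(Λ₁) = d²·covol(Λ₁)`, so `m·n = d²`.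
-/

set_option linter.dupNamespace false

namespace Summit.BirchSwinnertonDyer.BirchSwinnertonDyer.Theorems.CartanCover

open MeasureTheory

/-- **(COVOL)**: for period pairs `L₁, L₂`, `α ∈ ℂ` and `d ≥ 1` with `α·Λ₂ ⊆ Λ₁` and `d·Λ₁ ⊆ α·Λ₂` there is
`n > 0`, `n ∣ d²`, with `|α|²·covol(Λ₂) = n·covol(Λ₁)` (`n = [Λ₁ : αΛ₂]`). This is the statement
`Cruxes.CartanOnePlaceDegreeLawAtThree.Petarea.CovolumeIndex` verbatim. [folklore] -/
theorem covolumeIndex :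
    ∀ (L₁ L₂ : PeriodPair) (α : ℂ) (d : ℕ), 0 < d → (∀ x ∈ L₂.lattice, α * x ∈ L₁.lattice) →
      (∀ y ∈ L₁.lattice, ∃ x ∈ L₂.lattice, (d : ℂ) * y = α * x) →
      ∃ n : ℕ, 0 < n ∧ n ∣ d ^ 2 ∧
        ‖α‖ ^ 2 * ZLattice.covolume L₂.lattice = n * ZLattice.covolume L₁.lattice := by
  intro L₁ L₂ α d hd h₁ h₂
  have hd0 : (d : ℂ) ≠ 0 := by exact_mod_cast hd.ne'
  -- `α ≠ 0`: otherwise `d · ω₁ = 0`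
  have hα : α ≠ 0 := by
    rintro rfl
    obtain ⟨x, -, hx⟩ := h₂ _ L₁.ω₁_mem_lattice
    rw [zero_mul, mul_eq_zero] at hx
    rcases hx with hx | hx
    · exact hd0 hx
    · exact (L₁.indep.ne_zero 0) (by simpa using hx)
  -- the two intermediate lattices `αΛ₂` and `dΛ₁`
  have hM : (L₂.mulLeft α hα).lattice ≤ L₁.lattice := by
    intro x hx
    have hx' := h₁ _ (PeriodPair.mem_mulLeft_lattice.mp hx)
    rwa [← mul_assoc, mul_inv_cancel₀ hα, one_mul] at hx'
  have hD : (L₁.mulLeft (d : ℂ) hd0).lattice ≤ (L₂.mulLeft α hα).lattice := by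
    intro y hy
    obtain ⟨x, hx, hdx⟩ := h₂ _ (PeriodPair.mem_mulLeft_lattice.mp hy)
    rw [← mul_assoc, mul_inv_cancel₀ hd0, one_mul] at hdx
    rw [hdx]
    exact PeriodPair.mul_mem_mulLeft_lattice.mpr hx
  -- covolume ratios are the indices
  have r₁ := ZLattice.covolume_div_covolume_eq_relIndex' (L₂.mulLeft α hα).lattice L₁.lattice hM
  have r₂ := ZLattice.covolume_div_covolume_eq_relIndex' (L₁.mulLeft (d : ℂ) hd0).lattice
    (L₂.mulLeft α hα).lattice hD
  have cM : ZLattice.covolume (L₂.mulLeft α hα).lattice = ‖α‖ ^ 2 * ZLattice.covolume L₂.lattice :=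
    PeriodPair.covolume_mulLeft_lattice L₂ α hα
  have cD : ZLattice.covolume (L₁.mulLeft (d : ℂ) hd0).lattice =
      (d : ℝ) ^ 2 * ZLattice.covolume L₁.lattice := by
    rw [PeriodPair.covolume_mulLeft_lattice L₁ (d : ℂ) hd0, Complex.norm_natCast]
  have p₁ : 0 < ZLattice.covolume L₁.lattice := ZLattice.covolume_pos L₁.lattice volume
  have p₂ : 0 < ZLattice.covolume L₂.lattice := ZLattice.covolume_pos L₂.lattice volume
  have pM : 0 < ZLattice.covolume (L₂.mulLeft α hα).lattice :=
    ZLattice.covolume_pos (L₂.mulLeft α hα).lattice volume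
  rw [div_eq_iff p₁.ne'] at r₁
  rw [div_eq_iff pM.ne'] at r₂
  -- name the indices
  obtain ⟨n, hn⟩ : ∃ n : ℕ, ((L₂.mulLeft α hα).lattice.toAddSubgroup.relIndex L₁.lattice.toAddSubgroup) = n :=
    ⟨_, rfl⟩
  obtain ⟨m, hm⟩ : ∃ m : ℕ, ((L₁.mulLeft (d : ℂ) hd0).lattice.toAddSubgroup.relIndex
      (L₂.mulLeft α hα).lattice.toAddSubgroup) = m := ⟨_, rfl⟩
  rw [hn] at r₁
  rw [hm] at r₂
  -- `n > 0`
  have hn0 : 0 < n := by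
    rcases Nat.eq_zero_or_pos n with h | h
    · rw [h, Nat.cast_zero, zero_mul] at r₁
      exact absurd r₁ pM.ne'
    · exact h
  -- `m · n = d²`
  have hmn : m * n = d ^ 2 := by
    have key : ((m : ℝ) * n) * ZLattice.covolume L₁.lattice = ((d : ℝ) ^ 2) * ZLattice.covolume L₁.lattice := by
      rw [← cD, r₂, r₁]; ring
    have := mul_right_cancel₀ p₁.ne' key
    exact_mod_cast this
  refine ⟨n, hn0, ⟨m, by rw [← hmn, mul_comm]⟩, ?_⟩
  rw [← cM, r₁]

end Summit.BirchSwinnertonDyer.BirchSwinnertonDyer.Theorems.CartanCover
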